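import Summits.AtomisticToContinuum.HydrodynamicLimit.Theorems.LambertianContactSwapLambertianEulerKlLedger
import Summits.AtomisticToContinuum.HydrodynamicLimit.Theorems.LambertianContactSwapSwapGapEntropyBudgetStatics
import Literature.MathematicalPhysics.KineticTheory.LambertianRedrawNondegenerate
import HarnessLib

/-!
# The a priori `O(N + 1)` relative-entropy bound of the Lambertian gas (crux `LambertianEuler`, stmt-AtomisticToContinuum-11854, line `Sketch`, stub `stub_aprioriEntropyBoundLambda`)

Worker file (`--supports stmt-AtomisticToContinuum-11854`) closing the registered stub
`stub_aprioriEntropyBoundLambda` of the lead's skeleton of line `Sketch`: step 0 of Yau's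
relative-entropy method for the LAMBERTIAN hard-sphere gas `Λ` on `𝕋³`
(`lambertFlow G ε ξs z s`: free flight + hard-sphere collisions at which the outgoing relative velocity
of the colliding pair is redrawn with the cosine law from the i.i.d. Gaussian noise
`ξs ~ γ^ℕ = lambertNoise (Fin 3)`).

**Statement.** Let `0 < σ < 1/2`, `λ_N = localGibbsLaw σ a₀ u₀ θ₀ N Φ` the local Gibbs law of
`N + 1` spheres of diameter `hsDiameter σ N` with continuous positive data profiles, and `μ_s` the law
of `Λ_s` under `λ_N ⊗ γ^ℕ`. For all bounds `0 < m`, `M` there is `C = C(σ, a₀, θ₀, u₀, m, M)` such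
that for every continuous reference triple `(b, w, ϑ)` with `m ≤ b, ϑ ≤ M`, `‖w‖ ≤ M`, every `N`,
flow `Φ` and `s ≥ 0`: `KL(μ_s ‖ ψ_{b,w,ϑ}) < ∞` and `KL(μ_s ‖ ψ_{b,w,ϑ}) ≤ C (N + 1)`.

**Proof.** The landed relative-entropy LEDGER of `Λ`
(`LambertianContactSwapLambertianEulerKlLedger.stub_klLedgerLambda`) with `P := λ_N` and time-`0`
reference `λ_N` itself (`klDiv_self`) gives finiteness and
`KL(μ_s ‖ ψ) ≤ E_{λ_N ⊗ γ^ℕ}[log ρ_λ(z) − log ρ_ψ(Λ_s(z, ξs))]`. On the hard-sphere domain (where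
`z` and `Λ_s(z, ξs)` lie almost surely, by the `Λ`-Liouville theorem) both log-densities are a
c-number plus a ONE-BODY sum (`EntropyClockDock.log_canonicalDensity_localGibbsProfile`); dropping
the non-positive kinetic term of `log ρ_λ`, bounding `|log a₀|, |log 2πθ₀|` by compactness,
`−log b ≤ |log m|`, `log 2πϑ ≤ |log 2πM'|`, `|v' − w|²/(2ϑ) ≤ (|v'|² + M'²)/m` (`M' = max M m`),
the pathwise energy monotonicity `Σ|v'_i|² ≤ Σ|v_i|²` (`configEnergy_lambertFlow_le`) and the uniform
comparison of configurational partition functions `log Z_b − log Z_{a₀} ≤ (N+1)(log M' − log inf a₀)`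
give the pointwise bound `A (N + 1) + m⁻¹ Σ_i |v_i|²`, and `E_{λ_N} Σ_i |v_i|² ≤ C₃ (N + 1)`
(`exists_lintegral_sum_norm_sq_localGibbsLaw_le`).

References: H.-T. Yau, *Relative entropy and hydrodynamics of Ginzburg–Landau models*, Lett. Math.
Phys. 22 (1991), §2; C. Kipnis, C. Landim, *Scaling limits of interacting particle systems* (1999),
Ch. 6 §1 (`H(μ^N | ν^N) ≤ C N` for local equilibria). prover-line-stmt-AtomisticToContinuum-11854-c3-0
(lead c3), stub worker.
-/

noncomputable section

namespace Summit.AtomisticToContinuum.HydrodynamicLimit.Theorems.LambertianContactSwapLambertianEulerAprioriEntropyBound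

open scoped BigOperators Topology ENNReal InnerProductSpace
open MeasureTheory ProbabilityTheory Filter Set InformationTheory
open Literature.MathematicalPhysics.KineticTheory
open Literature.Analysis.FluidPDE Literature.Analysis.FluidPDE.Alexander

/-! ### §1 Uniform statics: partition functions and one-body exponents -/

-- adapted from `exists_abs_log_posPartition_sub_le`
-- (Theorems/LambertianContactSwapSwapGapEntropyBudgetStatics.lean)
/-- **One-sided UNIFORM comparison of configurational partition functions**: for continuous
activities `a ≥ ma > 0` and `0 < b ≤ Mb` on `𝕋³`, at reduced diameter `σ ≤ 1/2`,
`log Z_b − log Z_a ≤ (log Mb − log ma) (N + 1)` — both partition functions are integrals of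
`∏ activity` over the same non-overlap set, so `ma^{N+1} |D_N| ≤ Z_a` and `Z_b ≤ Mb^{N+1} |D_N|`.
[folklore] -/
theorem log_posPartition_sub_le {a b : T3 → ℝ} (ha : Continuous a) (hb : Continuous b)
    (ha0 : ∀ x, 0 < a x) (hb0 : ∀ x, 0 < b x) {ma Mb : ℝ} (hma0 : 0 < ma) (hma : ∀ x, ma ≤ a x)
    (hMb : ∀ x, b x ≤ Mb) {σ : ℝ} (hσ2 : σ ≤ 1 / 2) (N : ℕ) :
    Real.log (posPartition b (hsDiameter σ N) (N + 1)) -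
        Real.log (posPartition a (hsDiameter σ N) (N + 1)) ≤
      (Real.log Mb - Real.log ma) * ((N : ℝ) + 1) := by
  have hMb0 : 0 < Mb := (hb0 0).trans_le (hMb 0)
  have hZb := posPartition_pos hb hb0 hσ2 N
  set ε := hsDiameter σ N
  set V : ℝ := (volume : Measure (Fin (N + 1) → T3)).real (posDomain ε (N + 1)) with hV
  have hVpos : 0 < V := volume_real_posDomain_pos hσ2 N
  have hind : Integrable ((posDomain ε (N + 1)).indicator fun _ => (1 : ℝ))
      (volume : Measure (Fin (N + 1) → T3)) :=
    (integrable_const _).indicator (measurableSet_posDomain _ _)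
  have hintind : ∫ x, (posDomain ε (N + 1)).indicator (fun _ => (1 : ℝ)) x = V := by
    rw [integral_indicator_const _ (measurableSet_posDomain _ _), smul_eq_mul, mul_one]
  have hlow : ma ^ (N + 1) * V ≤ posPartition a ε (N + 1) := by
    rw [posPartition, ← hintind, ← integral_const_mul]
    exact integral_mono (hind.const_mul _) (integrable_posWeight ha (fun x => (ha0 x).le) _ _)
      fun x => pow_mul_indicator_le_posWeight hma0.le hma ε x
  have hup : posPartition b ε (N + 1) ≤ Mb ^ (N + 1) * V := by
    rw [posPartition, ← hintind, ← integral_const_mul]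
    exact integral_mono (integrable_posWeight hb (fun x => (hb0 x).le) _ _) (hind.const_mul _)
      fun x => posWeight_le_pow_mul_indicator (fun x => (hb0 x).le) hMb ε x
  have hb' := Real.log_le_log hZb hup
  have ha' := Real.log_le_log (by positivity) hlow
  rw [Real.log_mul (pow_pos hMb0 _).ne' hVpos.ne', Real.log_pow] at hb'
  rw [Real.log_mul (pow_pos hma0 _).ne' hVpos.ne', Real.log_pow] at ha'
  push_cast at hb' ha'
  nlinarith

/-- **Upper bound of the one-body exponent of the data**: dropping the non-positive kinetic term,
`log a(x) − (3/2) log(2πθ(x)) − |v − u(x)|²/(2θ(x)) ≤ Ka + (3/2) Kθ` whenever `|log a| ≤ Ka`,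
`|log 2πθ| ≤ Kθ`, `θ > 0`. [folklore] -/
theorem oneBody_le {a θ : T3 → ℝ} {u : T3 → V3} {Ka Kθ : ℝ} (hKa : ∀ x, |Real.log (a x)| ≤ Ka)
    (hKθ : ∀ x, |Real.log (2 * Real.pi * θ x)| ≤ Kθ) (hθ0 : ∀ x, 0 < θ x) (x : T3) (v : V3) :
    Real.log (a x) - 3 / 2 * Real.log (2 * Real.pi * θ x) - ‖v - u x‖ ^ 2 / (2 * θ x) ≤
      Ka + 3 / 2 * Kθ := by
  have h1 : Real.log (a x) ≤ Ka := (le_abs_self _).trans (hKa x)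
  have h2 : -Kθ ≤ Real.log (2 * Real.pi * θ x) := (abs_le.1 (hKθ x)).1
  have h3 : 0 ≤ ‖v - u x‖ ^ 2 / (2 * θ x) := by
    have := hθ0 x
    positivity
  linarith

/-- **Lower bound of the one-body exponent of the reference, uniform within the profile bounds**:
if `0 < m ≤ b`, `m ≤ ϑ ≤ M'` and `|w| ≤ M'`, then
`−(log b(x) − (3/2) log(2πϑ(x)) − |v − w(x)|²/(2ϑ(x))) ≤ |log m| + (3/2)|log 2πM'| + M'²/m + |v|²/m`
(`|v − w|² ≤ 2|v|² + 2M'²`, `2ϑ ≥ 2m`). [folklore] -/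
theorem neg_oneBody_le {b ϑ : T3 → ℝ} {w : T3 → V3} {m M' : ℝ} (hm : 0 < m)
    (hbm : ∀ x, m ≤ b x) (hϑm : ∀ x, m ≤ ϑ x ∧ ϑ x ≤ M') (hwM : ∀ x, ‖w x‖ ≤ M') (x : T3)
    (v : V3) :
    -(Real.log (b x) - 3 / 2 * Real.log (2 * Real.pi * ϑ x) - ‖v - w x‖ ^ 2 / (2 * ϑ x)) ≤
      |Real.log m| + 3 / 2 * |Real.log (2 * Real.pi * M')| + m⁻¹ * M' ^ 2 + m⁻¹ * ‖v‖ ^ 2 := by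
  have hϑ0 : 0 < ϑ x := hm.trans_le (hϑm x).1
  have h1 : -|Real.log m| ≤ Real.log (b x) := (neg_abs_le _).trans (Real.log_le_log hm (hbm x))
  have h2 : Real.log (2 * Real.pi * ϑ x) ≤ |Real.log (2 * Real.pi * M')| :=
    (Real.log_le_log (by positivity) (mul_le_mul_of_nonneg_left (hϑm x).2 (by positivity))).trans
      (le_abs_self _)
  have h3 : ‖v - w x‖ ^ 2 / (2 * ϑ x) ≤ m⁻¹ * M' ^ 2 + m⁻¹ * ‖v‖ ^ 2 := by
    have hvw : ‖v - w x‖ ≤ ‖v‖ + M' := (norm_sub_le _ _).trans (add_le_add le_rfl (hwM x))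
    have hsq : ‖v - w x‖ ^ 2 ≤ 2 * ‖v‖ ^ 2 + 2 * M' ^ 2 := by
      nlinarith [pow_le_pow_left₀ (norm_nonneg _) hvw 2, sq_nonneg (‖v‖ - M')]
    rw [← mul_add, ← div_eq_inv_mul, div_le_div_iff₀ (by positivity) hm]
    nlinarith [mul_le_mul_of_nonneg_right hsq hm.le,
      mul_le_mul_of_nonneg_left (hϑm x).1 (by positivity : (0 : ℝ) ≤ 2 * (M' ^ 2 + ‖v‖ ^ 2))]
  linarith

/-- **Pointwise bound of the entropy-ledger integrand on the hard-sphere domain.** For the data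
profiles `(a₀, u₀, θ₀)` (`a₀ ≥ ma > 0`, `|log a₀| ≤ Ka`, `|log 2πθ₀| ≤ Kθ`) and a reference
`(b, w, ϑ)` within the bounds `m ≤ b, ϑ ≤ M'`, `|w| ≤ M'`, at two points `z, z'` of the hard-sphere
domain with `Σ_i |v'_i|² ≤ Σ_i |v_i|²`:
`log ρ_λ(z) − log ρ_ψ(z') ≤ A (N + 1) + m⁻¹ Σ_i |v_i|²` with the explicit constant
`A = log M' − log ma + Ka + (3/2) Kθ + |log m| + (3/2)|log 2πM'| + M'²/m`. [cite: Yau1991, §2] -/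
theorem logRatio_le {σ : ℝ} (hσ2 : σ ≤ 1 / 2) {a₀ θ₀ b ϑ : T3 → ℝ} {u₀ w : T3 → V3}
    (ha : Continuous a₀) (hθ : Continuous θ₀) (hu : Continuous u₀) (ha0 : ∀ x, 0 < a₀ x)
    (hθ0 : ∀ x, 0 < θ₀ x) (hb : Continuous b) (hϑ : Continuous ϑ) (hw : Continuous w)
    {m M' ma Ka Kθ : ℝ} (hm : 0 < m) (hbm : ∀ x, m ≤ b x ∧ b x ≤ M')
    (hϑm : ∀ x, m ≤ ϑ x ∧ ϑ x ≤ M') (hwM : ∀ x, ‖w x‖ ≤ M') (hma0 : 0 < ma)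
    (hma : ∀ x, ma ≤ a₀ x) (hKa : ∀ x, |Real.log (a₀ x)| ≤ Ka)
    (hKθ : ∀ x, |Real.log (2 * Real.pi * θ₀ x)| ≤ Kθ) (N : ℕ) {z z' : Config (N + 1) (Fin 3) T3}
    (hz : z ∈ hardSphereDomain (Torus.geometry (Fin 3)) (N + 1) (hsDiameter σ N))
    (hz' : z' ∈ hardSphereDomain (Torus.geometry (Fin 3)) (N + 1) (hsDiameter σ N))
    (hen : ∑ i, ‖(z' i).2‖ ^ 2 ≤ ∑ i, ‖(z i).2‖ ^ 2) :
    Real.log (canonicalDensity (Torus.geometry (Fin 3)) (hsDiameter σ N) (N + 1)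
        (localGibbsProfile a₀ u₀ θ₀) z) -
      Real.log (canonicalDensity (Torus.geometry (Fin 3)) (hsDiameter σ N) (N + 1)
        (localGibbsProfile b w ϑ) z') ≤
      (Real.log M' - Real.log ma + (Ka + 3 / 2 * Kθ) +
          (|Real.log m| + 3 / 2 * |Real.log (2 * Real.pi * M')| + m⁻¹ * M' ^ 2)) * ((N : ℝ) + 1) +
        m⁻¹ * ∑ i, ‖(z i).2‖ ^ 2 := by
  have hb0 : ∀ x, 0 < b x := fun x => hm.trans_le (hbm x).1
  have hϑ0 : ∀ x, 0 < ϑ x := fun x => hm.trans_le (hϑm x).1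
  rw [EntropyClockDock.log_canonicalDensity_localGibbsProfile ha hθ hu ha0 hθ0 hσ2 N hz,
    EntropyClockDock.log_canonicalDensity_localGibbsProfile hb hϑ hw hb0 hϑ0 hσ2 N hz']
  have hZ := log_posPartition_sub_le ha hb ha0 hb0 hma0 hma (fun x => (hbm x).2) hσ2 N
  have h1 : ∑ i, (Real.log (a₀ (z i).1) - 3 / 2 * Real.log (2 * Real.pi * θ₀ (z i).1) -
      ‖(z i).2 - u₀ (z i).1‖ ^ 2 / (2 * θ₀ (z i).1)) ≤ ∑ _i : Fin (N + 1), (Ka + 3 / 2 * Kθ) :=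
    Finset.sum_le_sum fun i _ => oneBody_le (u := u₀) hKa hKθ hθ0 _ _
  have h2 : -∑ i, (Real.log (b (z' i).1) - 3 / 2 * Real.log (2 * Real.pi * ϑ (z' i).1) -
      ‖(z' i).2 - w (z' i).1‖ ^ 2 / (2 * ϑ (z' i).1)) ≤
      ∑ i, (|Real.log m| + 3 / 2 * |Real.log (2 * Real.pi * M')| + m⁻¹ * M' ^ 2 +
        m⁻¹ * ‖(z' i).2‖ ^ 2) := by
    rw [← Finset.sum_neg_distrib]
    exact Finset.sum_le_sum fun i _ => neg_oneBody_le hm (fun x => (hbm x).1) hϑm hwM _ _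
  rw [Finset.sum_add_distrib, Finset.sum_const, Finset.card_univ, Fintype.card_fin, nsmul_eq_mul,
    ← Finset.mul_sum] at h2
  rw [Finset.sum_const, Finset.card_univ, Fintype.card_fin, nsmul_eq_mul] at h1
  have h4 : m⁻¹ * ∑ i, ‖(z' i).2‖ ^ 2 ≤ m⁻¹ * ∑ i, ‖(z i).2‖ ^ 2 :=
    mul_le_mul_of_nonneg_left hen (inv_nonneg.2 hm.le)
  push_cast at h1 h2
  linarith

/-! ### §2 The stub -/

/-- **Registered stub `stub_aprioriEntropyBoundLambda` of line `Sketch` — the a priori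
relative-entropy bound of the Lambertian gas** (Yau's method, step 0: the relative entropy with
respect to ANY smooth local Gibbs reference is `O(N)` at all times). For `0 < σ < 1/2`, continuous
positive data profiles `(a₀, u₀, θ₀)` and bounds `0 < m`, `M`, there is `C` such that for every
continuous reference triple `(b, w, ϑ)` with `m ≤ b, ϑ ≤ M`, `‖w‖ ≤ M`, every `N`, flow `Φ` and
`s ≥ 0`, the law `μ_s` of `Λ_s` under `λ_N ⊗ γ^ℕ` satisfies `KL(μ_s ‖ ψ_{b,w,ϑ}) < ∞` and
`KL(μ_s ‖ ψ_{b,w,ϑ}) ≤ C (N + 1)`. Route: the ledger `stub_klLedgerLambda` with `P := λ_N` and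
time-`0` reference `λ_N` (`klDiv_self`), the pointwise bound `logRatio_le` of its integrand on the
hard-sphere domain (a.s., by the `Λ`-Liouville theorem `stub_liouvilleInvarianceLambda`) through the
pathwise energy monotonicity `configEnergy_lambertFlow_le`, and the Gaussian second moment
`E_{λ_N} Σ_i |v_i|² ≤ C₃ (N + 1)` (`exists_lintegral_sum_norm_sq_localGibbsLaw_le`).
[cite: Yau1991, §2] -/
theorem stub_aprioriEntropyBoundLambda :
    ∀ {σ : ℝ}, 0 < σ → σ < 2⁻¹ → ∀ {a₀ θ₀ : T3 → ℝ} {u₀ : T3 → V3},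
      Continuous a₀ → Continuous θ₀ → Continuous u₀ → (∀ x, 0 < a₀ x) → (∀ x, 0 < θ₀ x) →
      ∀ (m M : ℝ), 0 < m → ∃ C : ℝ, ∀ {b ϑ : T3 → ℝ} {w : T3 → V3},
        Continuous b → Continuous ϑ → Continuous w →
        (∀ x, m ≤ b x ∧ b x ≤ M) → (∀ x, m ≤ ϑ x ∧ ϑ x ≤ M) → (∀ x, ‖w x‖ ≤ M) →
        ∀ (N : ℕ) (Φ : HardSphereFlow (Torus.geometry (Fin 3)) (hsDiameter σ N) (N + 1)) (s : ℝ),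
          0 ≤ s →
          klDiv (((localGibbsLaw σ a₀ u₀ θ₀ N Φ).prod (lambertNoise (Fin 3))).map
              (fun p => lambertFlow (Torus.geometry (Fin 3)) (hsDiameter σ N) p.2 p.1 s))
            (localGibbsLaw σ b w ϑ N Φ) ≠ ⊤ ∧
          (klDiv (((localGibbsLaw σ a₀ u₀ θ₀ N Φ).prod (lambertNoise (Fin 3))).map
              (fun p => lambertFlow (Torus.geometry (Fin 3)) (hsDiameter σ N) p.2 p.1 s))
            (localGibbsLaw σ b w ϑ N Φ)).toReal ≤ C * ((N : ℝ) + 1) := by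
  intro σ hσ hσ' a₀ θ₀ u₀ ha hθ hu ha0 hθ0 m M hm
  have hσ2 : σ ≤ 1 / 2 := by rw [one_div]; exact hσ'.le
  -- constants depending only on `σ, a₀, θ₀, u₀, m, M`
  obtain ⟨ma, hma0, hma⟩ := exists_pos_le_of_continuous ha ha0
  obtain ⟨Ka, -, hKa⟩ := exists_abs_log_le_of_continuous ha ha0
  obtain ⟨Kθ, -, hKθ⟩ := exists_abs_log_le_of_continuous (f := fun x => 2 * Real.pi * θ₀ x)
    (continuous_const.mul hθ) (fun x => mul_pos (mul_pos two_pos Real.pi_pos) (hθ0 x))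
  obtain ⟨C₃, hC₃0, hC₃⟩ := exists_lintegral_sum_norm_sq_localGibbsLaw_le ha hθ hu ha0 hθ0 hσ2
  obtain ⟨M', hMM', hmM'⟩ : ∃ M' : ℝ, M ≤ M' ∧ m ≤ M' := ⟨max M m, le_max_left _ _, le_max_right _ _⟩
  obtain ⟨A, hA⟩ : ∃ A : ℝ, A = Real.log M' - Real.log ma + (Ka + 3 / 2 * Kθ) +
      (|Real.log m| + 3 / 2 * |Real.log (2 * Real.pi * M')| + m⁻¹ * M' ^ 2) := ⟨_, rfl⟩
  refine ⟨A + m⁻¹ * C₃, ?_⟩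
  intro b ϑ w hb hϑ hw hbB hϑB hwB N Φ s hs
  -- the reference profiles are positive and within the enlarged bounds `m ≤ · ≤ M'`
  have hb0 : ∀ x, 0 < b x := fun x => hm.trans_le (hbB x).1
  have hϑ0 : ∀ x, 0 < ϑ x := fun x => hm.trans_le (hϑB x).1
  have hbM : ∀ x, m ≤ b x ∧ b x ≤ M' := fun x => ⟨(hbB x).1, (hbB x).2.trans hMM'⟩
  have hϑM : ∀ x, m ≤ ϑ x ∧ ϑ x ≤ M' := fun x => ⟨(hϑB x).1, (hϑB x).2.trans hMM'⟩
  have hwM : ∀ x, ‖w x‖ ≤ M' := fun x => (hwB x).trans hMM'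
  -- σ-finiteness of the Liouville measure (instance path made explicit), unit mass of `λ_N`
  haveI hXE : SigmaFinite (volume : Measure (T3 × V3)) := inferInstance
  haveI hC : SigmaFinite (volume : Measure (Config (N + 1) (Fin 3) T3)) := inferInstance
  haveI hL : SigmaFinite (liouville (Torus.geometry (Fin 3)) (N + 1) (hsDiameter σ N)) := by
    rw [liouville_eq]; infer_instance
  haveI i₁ : IsProbabilityMeasure (localGibbsLaw σ a₀ u₀ θ₀ N Φ) :=
    isProbabilityMeasure_localGibbsLaw ha hθ hu ha0 hθ0 hσ2 N Φ
  -- `λ_N ≪ L`, integrable kinetic energy, `KL(λ_N ‖ λ_N) = 0`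
  have hPL : localGibbsLaw σ a₀ u₀ θ₀ N Φ ≪
      liouville (Torus.geometry (Fin 3)) (N + 1) (hsDiameter σ N) := by
    rw [localGibbsLaw_eq_withDensity_liouville]; exact withDensity_absolutelyContinuous _ _
  have hE := QuenchedCellClock.integrable_sum_norm_sq_localGibbsLaw ha hθ hu (fun x => (ha0 x).le)
    hθ0 N Φ
  have hkl0 : klDiv (localGibbsLaw σ a₀ u₀ θ₀ N Φ) (localGibbsLaw σ a₀ u₀ θ₀ N Φ) = 0 := klDiv_self _
  -- the ledger, started from `λ_N` with time-`0` reference `λ_N`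
  obtain ⟨hne, hle⟩ := LambertianContactSwapLambertianEulerKlLedger.stub_klLedgerLambda hσ hσ' ha hθ
    hu ha0 hθ0 hb hϑ hw hb0 hϑ0 N Φ (localGibbsLaw σ a₀ u₀ θ₀ N Φ) hPL hE
    (by rw [hkl0]; exact ENNReal.zero_ne_top) s hs
  refine ⟨hne, ?_⟩
  rw [hkl0, ENNReal.toReal_zero, sub_zero] at hle
  -- the Lambertian flow at time `s`: jointly measurable, transports `L ⊗ γ` to `L`
  have hε : 0 < hsDiameter σ N := hsDiameter_pos hσ N
  have hε' : hsDiameter σ N < 2⁻¹ := (hsDiameter_le hσ.le N).trans_lt hσ'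
  have hΛ := measurable_lambertFlow_hsDiameter hσ.le hσ' N s
  have hinv := LambertianContactSwapSwapGapLiouvilleInvarianceLambda.stub_liouvilleInvarianceLambda
    (hsDiameter σ N) hε hε' (N + 1) s hs
  have hq : Measure.QuasiMeasurePreserving
      (fun p : Config (N + 1) (Fin 3) T3 × (ℕ → V3) =>
        lambertFlow (Torus.geometry (Fin 3)) (hsDiameter σ N) p.2 p.1 s)
      ((liouville (Torus.geometry (Fin 3)) (N + 1) (hsDiameter σ N)).prod (lambertNoise (Fin 3)))
      (liouville (Torus.geometry (Fin 3)) (N + 1) (hsDiameter σ N)) :=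
    ⟨hΛ, Measure.absolutelyContinuous_of_le hinv.le⟩
  -- a.s. under `λ_N ⊗ γ`, both `z` and `Λ_s (z, ξs)` lie in the hard-sphere domain
  have hDL : ∀ᵐ z ∂liouville (Torus.geometry (Fin 3)) (N + 1) (hsDiameter σ N),
      z ∈ hardSphereDomain (Torus.geometry (Fin 3)) (N + 1) (hsDiameter σ N) := by
    rw [liouville_eq]
    exact ae_restrict_mem (measurableSet_hardSphereDomain _ Torus.measurable_geometry_sepVec _ _)
  have hac : (localGibbsLaw σ a₀ u₀ θ₀ N Φ).prod (lambertNoise (Fin 3)) ≪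
      (liouville (Torus.geometry (Fin 3)) (N + 1) (hsDiameter σ N)).prod (lambertNoise (Fin 3)) :=
    hPL.prod Measure.AbsolutelyContinuous.rfl
  have hD : ∀ᵐ p ∂((localGibbsLaw σ a₀ u₀ θ₀ N Φ).prod (lambertNoise (Fin 3))),
      p.1 ∈ hardSphereDomain (Torus.geometry (Fin 3)) (N + 1) (hsDiameter σ N) ∧
      lambertFlow (Torus.geometry (Fin 3)) (hsDiameter σ N) p.2 p.1 s ∈
        hardSphereDomain (Torus.geometry (Fin 3)) (N + 1) (hsDiameter σ N) :=
    hac.ae_le ((Measure.quasiMeasurePreserving_fst.ae hDL).and (hq.ae hDL))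
  -- pathwise energy monotonicity and integrability of the two one-body sums
  have hE1 : Integrable (fun p : Config (N + 1) (Fin 3) T3 × (ℕ → V3) => ∑ i, ‖(p.1 i).2‖ ^ 2)
      ((localGibbsLaw σ a₀ u₀ θ₀ N Φ).prod (lambertNoise (Fin 3))) := hE.comp_fst _
  have hen : ∀ p : Config (N + 1) (Fin 3) T3 × (ℕ → V3),
      ∑ i, ‖(lambertFlow (Torus.geometry (Fin 3)) (hsDiameter σ N) p.2 p.1 s i).2‖ ^ 2 ≤
        ∑ i, ‖(p.1 i).2‖ ^ 2 := fun p => by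
    have h := configEnergy_lambertFlow_le (G := Torus.geometry (Fin 3)) (ε := hsDiameter σ N)
      p.2 p.1 s
    simp only [configEnergy] at h
    linarith
  have hS₀ := LambertianContactSwapLambertianEulerKlLedger.integrable_sum_oneBody_comp
    ((localGibbsLaw σ a₀ u₀ θ₀ N Φ).prod (lambertNoise (Fin 3))) ha hθ hu ha0 hθ0
    measurable_fst hE1 (fun p => le_rfl)
  have hS := LambertianContactSwapLambertianEulerKlLedger.integrable_sum_oneBody_comp
    ((localGibbsLaw σ a₀ u₀ θ₀ N Φ).prod (lambertNoise (Fin 3))) hb hϑ hw hb0 hϑ0 hΛ hE1 hen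
  have hI₀ : Integrable (fun p : Config (N + 1) (Fin 3) T3 × (ℕ → V3) =>
      Real.log (canonicalDensity (Torus.geometry (Fin 3)) (hsDiameter σ N) (N + 1)
        (localGibbsProfile a₀ u₀ θ₀) p.1))
      ((localGibbsLaw σ a₀ u₀ θ₀ N Φ).prod (lambertNoise (Fin 3))) := by
    refine ((integrable_const (-Real.log (posPartition a₀ (hsDiameter σ N) (N + 1)))).add
      hS₀).congr ?_
    filter_upwards [hD] with p hp
    rw [Pi.add_apply]
    exact (EntropyClockDock.log_canonicalDensity_localGibbsProfile ha hθ hu ha0 hθ0 hσ2 N hp.1).symm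
  have hI : Integrable (fun p : Config (N + 1) (Fin 3) T3 × (ℕ → V3) =>
      Real.log (canonicalDensity (Torus.geometry (Fin 3)) (hsDiameter σ N) (N + 1)
        (localGibbsProfile b w ϑ)
        (lambertFlow (Torus.geometry (Fin 3)) (hsDiameter σ N) p.2 p.1 s)))
      ((localGibbsLaw σ a₀ u₀ θ₀ N Φ).prod (lambertNoise (Fin 3))) := by
    refine ((integrable_const (-Real.log (posPartition b (hsDiameter σ N) (N + 1)))).add
      hS).congr ?_
    filter_upwards [hD] with p hp
    rw [Pi.add_apply]
    exact (EntropyClockDock.log_canonicalDensity_localGibbsProfile hb hϑ hw hb0 hϑ0 hσ2 N hp.2).symm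
  have hint : Integrable (fun p : Config (N + 1) (Fin 3) T3 × (ℕ → V3) =>
      Real.log (canonicalDensity (Torus.geometry (Fin 3)) (hsDiameter σ N) (N + 1)
          (localGibbsProfile a₀ u₀ θ₀) p.1) -
        Real.log (canonicalDensity (Torus.geometry (Fin 3)) (hsDiameter σ N) (N + 1)
          (localGibbsProfile b w ϑ)
          (lambertFlow (Torus.geometry (Fin 3)) (hsDiameter σ N) p.2 p.1 s)))
      ((localGibbsLaw σ a₀ u₀ θ₀ N Φ).prod (lambertNoise (Fin 3))) := hI₀.sub hI
  -- the dominating function `A (N + 1) + m⁻¹ Σ_i |v_i|²` and the pointwise bound, a.s.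
  have hdom : Integrable (fun p : Config (N + 1) (Fin 3) T3 × (ℕ → V3) =>
      A * ((N : ℝ) + 1) + m⁻¹ * ∑ i, ‖(p.1 i).2‖ ^ 2)
      ((localGibbsLaw σ a₀ u₀ θ₀ N Φ).prod (lambertNoise (Fin 3))) :=
    (integrable_const _).add (hE1.const_mul _)
  have hpt : ∀ᵐ p ∂((localGibbsLaw σ a₀ u₀ θ₀ N Φ).prod (lambertNoise (Fin 3))),
      Real.log (canonicalDensity (Torus.geometry (Fin 3)) (hsDiameter σ N) (N + 1)
          (localGibbsProfile a₀ u₀ θ₀) p.1) -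
        Real.log (canonicalDensity (Torus.geometry (Fin 3)) (hsDiameter σ N) (N + 1)
          (localGibbsProfile b w ϑ)
          (lambertFlow (Torus.geometry (Fin 3)) (hsDiameter σ N) p.2 p.1 s)) ≤
      A * ((N : ℝ) + 1) + m⁻¹ * ∑ i, ‖(p.1 i).2‖ ^ 2 := by
    filter_upwards [hD] with p hp
    rw [hA]
    exact logRatio_le hσ2 ha hθ hu ha0 hθ0 hb hϑ hw hm hbM hϑM hwM hma0 hma hKa hKθ N hp.1 hp.2
      (hen p)
  -- the Gaussian second moment `E_{λ_N} Σ_i |v_i|² ≤ C₃ (N + 1)`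
  have hEC : ∫ z, ∑ i, ‖(z i).2‖ ^ 2 ∂(localGibbsLaw σ a₀ u₀ θ₀ N Φ) ≤ C₃ * ((N : ℝ) + 1) := by
    have h := hC₃ N Φ
    rw [← ofReal_integral_eq_lintegral_ofReal hE (Eventually.of_forall fun z =>
      Finset.sum_nonneg fun i _ => sq_nonneg ‖(z i).2‖)] at h
    exact (ENNReal.ofReal_le_ofReal_iff (mul_nonneg hC₃0 (by positivity))).1 h
  -- integrate
  refine hle.trans ((integral_mono_ae hint hdom hpt).trans ?_)
  rw [integral_add (integrable_const _) (hE1.const_mul _), integral_const, probReal_univ, one_smul,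
    integral_const_mul, integral_fun_fst (fun z : Config (N + 1) (Fin 3) T3 => ∑ i, ‖(z i).2‖ ^ 2),
    probReal_univ, one_smul]
  nlinarith [mul_le_mul_of_nonneg_left hEC (inv_nonneg.2 hm.le)]

end Summit.AtomisticToContinuum.HydrodynamicLimit.Theorems.LambertianContactSwapLambertianEulerAprioriEntropyBound

end
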